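import Summits.CriticalPhenomena.PercolationContinuityZ3.Theorems.Transplant.FKConnectivityAllQWheelTransfer
import Summits.CriticalPhenomena.PercolationContinuityZ3.Theorems.Transplant.FKConnectivityAllQWheelAutomaton
import HarnessLib

/-!
# Connectivity correlation inequalities for `φ_{w,q}`, every `q > 0` — APEX-OVER-CYCLE GRAPHS: the cyclic transfer WORD, its rotation invariance,
# and its evaluation at rigid parameters by the rim automaton

Support file (`--supports stmt-CriticalPhenomena-4575`), FK sub-lane `prim-bschramm-fk-3` (gen 8) of the post-continuity programme; builds on
p205010 (kernel theorem, internal audit signed; external expert review pending).  Pure 2×2 real algebra; no named facts, no sorries; standard axioms.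
Blueprint: bschramm/prim-bschramm-fk-3/WHEELS-HUB-NC.md §2 (LEMMA T) and §6.

For parameter sequences `p r : ℕ → ℝ` read modulo `n` (spoke and outgoing rim-pair parameter of rim vertex `j`), the LETTER of vertex `j` is
`edgeM q (r j) * spokeM (p j)` (`…AllQWheelTransfer.lean`) and the SEGMENT `seg a ℓ = letter (a+ℓ−1) ⋯ letter a` is the transfer product of `ℓ`
consecutive vertices from `a`.  Proved here:
* `seg_add`, `letter_add_period`, `seg_add_period`, **`trace_seg_rotate`** — concatenation, periodicity, and `Tr seg a n = Tr seg 0 n` (cyclic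
  invariance of the trace: the transfer formula does not depend on where the rim is cut open);
* **`seg_col_rigid`** — at RIGID parameters (`p j = [σ j]`, `r j = [τ j]`) the `no`-column of `seg 0 i` is `q^{c} e_s` where `(c, s) = FK.Wheel.run σ τ i`
  is the rim automaton of `…AllQWheelAutomaton.lean` (the rigid letters `P`, `1`, `K·P`, `K` act deterministically);
* **`trace_seg_rigid_of_cut`** — if the last rim pair is closed, `Tr seg 0 n = q^{(run σ τ n).1}`; **`trace_seg_rigid_of_no_cut`** — if all rim pairs are
  open, `Tr seg 0 n = 1` when some spoke is open and `= 2` otherwise (`seg 0 n = P` resp. `1`).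
Together with `FK.Wheel.clusterCount_conf_of_cut / _of_no_cut` this is the rigid case of LEMMA T: `q^{k(ω)} = q·Tr − q(2−q)·[all rim open, no spoke]`.
[cite: Grimmett2006, §1.2 eq. (1.1), §1.4 eq. (1.20) (pp. 4, 15)]
-/

noncomputable section

namespace Summit.CriticalPhenomena.PercolationContinuityZ3.Theorems

namespace FK

namespace Wheel

open Matrix WheelTM

/-- The transfer letter of rim vertex `j` (indices read modulo `n`): `E(r_j) · S(p_j)` — first the spoke, then the outgoing rim pair.
(transcription of bschramm/prim-bschramm-fk-3/WHEELS-HUB-NC.md §2) -/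
def letter (q : ℝ) (p r : ℕ → ℝ) (n j : ℕ) : Matrix (Fin 2) (Fin 2) ℝ := edgeM q (r (j % n)) * spokeM (p (j % n))

/-- The transfer product of the `ℓ` consecutive rim vertices `a, a+1, …, a+ℓ−1` (later vertices act later, i.e. on the left).
(transcription of bschramm/prim-bschramm-fk-3/WHEELS-HUB-NC.md §2) -/
def seg (q : ℝ) (p r : ℕ → ℝ) (n a : ℕ) : ℕ → Matrix (Fin 2) (Fin 2) ℝ
  | 0 => 1
  | ℓ + 1 => letter q p r n (a + ℓ) * seg q p r n a ℓ

variable (q : ℝ) (p r : ℕ → ℝ) (n : ℕ)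

/-- `seg a (ℓ+1) = letter (a+ℓ) · seg a ℓ`. [folklore] -/
theorem seg_succ (a ℓ : ℕ) : seg q p r n a (ℓ + 1) = letter q p r n (a + ℓ) * seg q p r n a ℓ := rfl

/-- `seg a 0 = 1`. [folklore] -/
theorem seg_zero (a : ℕ) : seg q p r n a 0 = 1 := rfl

/-- **Concatenation**: `seg a (ℓ₁ + ℓ₂) = seg (a + ℓ₁) ℓ₂ · seg a ℓ₁`. [folklore] -/
theorem seg_add (a ℓ₁ ℓ₂ : ℕ) : seg q p r n a (ℓ₁ + ℓ₂) = seg q p r n (a + ℓ₁) ℓ₂ * seg q p r n a ℓ₁ := by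
  induction ℓ₂ with
  | zero => rw [Nat.add_zero, seg_zero, Matrix.one_mul]
  | succ ℓ ih => rw [Nat.add_succ, seg_succ, ih, seg_succ, Matrix.mul_assoc, Nat.add_assoc]

/-- Letters are `n`-periodic. [folklore] -/
theorem letter_add_period (j : ℕ) : letter q p r n (j + n) = letter q p r n j := by
  unfold letter
  rw [Nat.add_mod_right]

/-- Segments are `n`-periodic in their starting point. [folklore] -/
theorem seg_add_period (a ℓ : ℕ) : seg q p r n (a + n) ℓ = seg q p r n a ℓ := by
  induction ℓ with
  | zero => rfl
  | succ ℓ ih => rw [seg_succ, seg_succ, ih, Nat.add_right_comm, letter_add_period]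

/-- **Rotation invariance of the trace**: `Tr seg a n = Tr seg 0 n` for `a ≤ n` (cyclicity of the trace: the word read from vertex `a` is a cyclic
rotation of the word read from vertex `0`). (transcription of bschramm/prim-bschramm-fk-3/WHEELS-HUB-NC.md §3) -/
theorem trace_seg_rotate (a : ℕ) (ha : a ≤ n) : (seg q p r n a n).trace = (seg q p r n 0 n).trace := by
  obtain ⟨b, hb⟩ : ∃ b, n = a + b := ⟨n - a, by omega⟩
  have h1 : seg q p r n 0 n = seg q p r n a b * seg q p r n 0 a := by
    have := seg_add q p r n 0 a b
    rw [Nat.zero_add, ← hb] at this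
    exact this
  have hp0 : seg q p r n n a = seg q p r n 0 a := by
    have := seg_add_period q p r n 0 a
    rw [Nat.zero_add] at this
    exact this
  have h2 : seg q p r n a n = seg q p r n 0 a * seg q p r n a b := by
    have := seg_add q p r n a b a
    rw [Nat.add_comm b a, ← hb] at this
    rw [this, hp0]
  rw [h1, h2, Matrix.trace_mul_comm]

/-! ### Rigid letters act deterministically -/

/-- The four rigid letters: `E(1)S(1) = P`, `E(1)S(0) = 1`, `E(0)S(1) = K·P = [[0,0],[1,1]]`, `E(0)S(0) = K = [[0,0],[1,q]]`, entrywise.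
(transcription of bschramm/prim-bschramm-fk-3/WHEELS-HUB-NC.md §2) -/
theorem letter_rigid_apply {σ τ : ℕ → Bool} (hp : ∀ j, p j = if σ j = true then 1 else 0) (hr : ∀ j, r j = if τ j = true then 1 else 0)
    (j : ℕ) (a b : Fin 2) :
    letter q p r n j a b =
      if τ (j % n) = true then (if σ (j % n) = true then (if a = 0 then 1 else 0) else (if a = b then 1 else 0))
      else (if a = 0 then 0 else (if σ (j % n) = true then 1 else (if b = 0 then 1 else q))) := by
  unfold letter
  rw [hp, hr]
  cases σ (j % n) <;> cases τ (j % n) <;> fin_cases a <;> fin_cases b <;>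
    simp [edgeM, spokeM, Matrix.mul_apply, Fin.sum_univ_two]

/-- **Rigid evaluation of the `no`-column**: at rigid parameters, for `i ≤ n`, the column `e_no` of `seg 0 i` is `q^{c}·e_s` with `(c, s) = run σ τ i`:
`(seg 0 i)₀₁ = [s]·q^c`, `(seg 0 i)₁₁ = [¬s]·q^c`. (transcription of bschramm/prim-bschramm-fk-3/WHEELS-HUB-NC.md §2) -/
theorem seg_col_rigid {σ τ : ℕ → Bool} (hp : ∀ j, p j = if σ j = true then 1 else 0) (hr : ∀ j, r j = if τ j = true then 1 else 0)
    (i : ℕ) (hi : i ≤ n) :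
    (seg q p r n 0 i) 0 1 = (if (run σ τ i).2 = true then q ^ (run σ τ i).1 else 0) ∧
      (seg q p r n 0 i) 1 1 = (if (run σ τ i).2 = true then 0 else q ^ (run σ τ i).1) := by
  induction i with
  | zero => simp [seg, run]
  | succ i ih =>
    obtain ⟨h0, h1⟩ := ih (by omega)
    have hin : i % n = i := Nat.mod_eq_of_lt (by omega)
    rw [seg_succ, Nat.zero_add]
    have e0 : (letter q p r n i * seg q p r n 0 i) 0 1 = letter q p r n i 0 0 * (seg q p r n 0 i) 0 1 + letter q p r n i 0 1 * (seg q p r n 0 i) 1 1 := by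
      rw [Matrix.mul_apply, Fin.sum_univ_two]
    have e1 : (letter q p r n i * seg q p r n 0 i) 1 1 = letter q p r n i 1 0 * (seg q p r n 0 i) 0 1 + letter q p r n i 1 1 * (seg q p r n 0 i) 1 1 := by
      rw [Matrix.mul_apply, Fin.sum_univ_two]
    rw [e0, e1, h0, h1, letter_rigid_apply q p r n hp hr i 0 0, letter_rigid_apply q p r n hp hr i 0 1,
      letter_rigid_apply q p r n hp hr i 1 0, letter_rigid_apply q p r n hp hr i 1 1, hin]
    cases hs : σ i <;> cases ht : τ i <;> cases h2 : (run σ τ i).2 <;>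
      (simp [run, step, hs, ht, h2]; try ring)

/-- **Trace at rigid parameters, cut at the end** (`τ (n−1) = false`, `1 ≤ n`): `Tr seg 0 n = q^{(run σ τ n).1}` — the last letter is `K·S`, of rank one,
and the trace reads off the `no`-column of the preceding product. (transcription of bschramm/prim-bschramm-fk-3/WHEELS-HUB-NC.md §2) -/
theorem trace_seg_rigid_of_cut {σ τ : ℕ → Bool} (hp : ∀ j, p j = if σ j = true then 1 else 0) (hr : ∀ j, r j = if τ j = true then 1 else 0)
    (hn : 1 ≤ n) (hcut : τ (n - 1) = false) :
    (seg q p r n 0 n).trace = q ^ (run σ τ n).1 := by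
  have hm : n - 1 + 1 = n := by omega
  obtain ⟨h0, h1⟩ := seg_col_rigid q p r n hp hr (n - 1) (by omega)
  have hmod : (n - 1) % n = n - 1 := Nat.mod_eq_of_lt (by omega)
  have hrun : (run σ τ n).1 = (run σ τ (n - 1)).1 + (if ((run σ τ (n - 1)).2 || σ (n - 1)) = true then 0 else 1) := by
    rw [← run_succ_fst_of_closed σ τ hcut, hm]
  have hseg : seg q p r n 0 n = letter q p r n (n - 1) * seg q p r n 0 (n - 1) := by
    rw [← hm, seg_succ, Nat.zero_add, hm]
  rw [hrun, hseg, Matrix.trace_fin_two, Matrix.mul_apply, Matrix.mul_apply, Fin.sum_univ_two, Fin.sum_univ_two, h0, h1,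
    letter_rigid_apply q p r n hp hr (n - 1) 0 0, letter_rigid_apply q p r n hp hr (n - 1) 0 1,
    letter_rigid_apply q p r n hp hr (n - 1) 1 0, letter_rigid_apply q p r n hp hr (n - 1) 1 1, hmod, hcut]
  cases hs : σ (n - 1) <;> cases h2 : (run σ τ (n - 1)).2 <;> (simp; try ring)

/-- At rigid parameters with all rim pairs open, `seg 0 i = P` if some spoke `< i` is open and `= 1` otherwise (`i ≤ n`). [folklore] -/
theorem seg_rigid_of_all_open {σ τ : ℕ → Bool} (hp : ∀ j, p j = if σ j = true then 1 else 0) (hr : ∀ j, r j = if τ j = true then 1 else 0)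
    (i : ℕ) (hi : i ≤ n) (hall : ∀ j, j < i → τ j = true) :
    seg q p r n 0 i = if (∃ j, j < i ∧ σ j = true) then !![1, 1; 0, 0] else 1 := by
  induction i with
  | zero => simp [seg]
  | succ i ih =>
    have h := ih (by omega) fun j hj => hall j (Nat.lt_succ_of_lt hj)
    have hin : i % n = i := Nat.mod_eq_of_lt (by omega)
    have hti : τ i = true := hall i (Nat.lt_succ_self i)
    -- the letter of vertex `i` is `P` or `1`
    have hL : letter q p r n i = if σ i = true then !![1, 1; 0, 0] else 1 := by
      ext a b
      rw [letter_rigid_apply q p r n hp hr i a b, hin, hti]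
      cases σ i <;> fin_cases a <;> fin_cases b <;> simp
    rw [seg_succ, Nat.zero_add, h, hL]
    have hex : (∃ j, j < i + 1 ∧ σ j = true) ↔ (∃ j, j < i ∧ σ j = true) ∨ σ i = true := by
      constructor
      · rintro ⟨j, hj, hs⟩
        rcases Nat.lt_succ_iff_lt_or_eq.1 hj with hj | rfl
        · exact Or.inl ⟨j, hj, hs⟩
        · exact Or.inr hs
      · rintro (⟨j, hj, hs⟩ | hs)
        · exact ⟨j, Nat.lt_succ_of_lt hj, hs⟩
        · exact ⟨i, Nat.lt_succ_self i, hs⟩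
    have hPP : (!![1, 1; 0, 0] : Matrix (Fin 2) (Fin 2) ℝ) * !![1, 1; 0, 0] = !![1, 1; 0, 0] := by
      ext a b; fin_cases a <;> fin_cases b <;> simp [Matrix.mul_apply, Fin.sum_univ_two]
    by_cases h1 : ∃ j, j < i ∧ σ j = true
    · rw [if_pos h1, if_pos (hex.2 (Or.inl h1))]
      cases hs : σ i
      · simp
      · simp [hPP]
    · rw [if_neg h1]
      cases hs : σ i
      · have : ¬ (∃ j, j < i + 1 ∧ σ j = true) := fun h' => by
          rcases hex.1 h' with h' | h'
          · exact h1 h'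
          · rw [hs] at h'; exact Bool.false_ne_true h'
        rw [if_neg this]; simp
      · rw [if_pos (hex.2 (Or.inr hs))]; simp

/-- **Trace at rigid parameters, no cut** (all rim pairs open): `Tr seg 0 n = 1` if some spoke is open, `= 2` otherwise.
(transcription of bschramm/prim-bschramm-fk-3/WHEELS-HUB-NC.md §2) -/
theorem trace_seg_rigid_of_no_cut {σ τ : ℕ → Bool} (hp : ∀ j, p j = if σ j = true then 1 else 0) (hr : ∀ j, r j = if τ j = true then 1 else 0)
    (hall : ∀ j, j < n → τ j = true) :
    (seg q p r n 0 n).trace = if (∃ j, j < n ∧ σ j = true) then 1 else 2 := by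
  rw [seg_rigid_of_all_open q p r n hp hr n le_rfl hall]
  by_cases h : ∃ j, j < n ∧ σ j = true
  · rw [if_pos h, if_pos h, Matrix.trace_fin_two]; simp
  · rw [if_neg h, if_neg h, Matrix.trace_fin_two]; norm_num

end Wheel

end FK

end Summit.CriticalPhenomena.PercolationContinuityZ3.Theorems

end
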